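import Mathlib
import HarnessLib

/-!
# RobustBall/FiniteHeatBathKernel — one-site heat-bath kernels of a finite spin system and the sharp
# total-variation bound `TV ≤ tanh(H/2) ≤ H/2` for a bounded tilt

HONEST FRAMING: elementary finite combinatorics / real analysis (finite sums only, no measure theory),
written for the centre-projection area law of track Y2 (cell `pub-ymgap`, seat ds-4 g7): the induced
`ℤ_N` gauge theory of a centre-blind perturbation is a FINITE spin system on `V → S`.  Nothing here is
specific to gauge theories and nothing is claimed about any continuum limit.

Contents (`[Fintype S]`, configurations `V → S`, a weight `w : (V → S) → ℝ`):
* the one-site partition function `siteZ`, the conditional law `hbProb w x σ` and the heat-bath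
  operator `hb w x` (resample the spin at `x`; Friedli–Velenik 2017 §6.5.2), with their order properties;
* the total-variation distance `tv w x σ τ = ∑_s (p_σ(s) − p_τ(s))⁺` of two one-site laws and the
  transport bound `|∑ (p_σ − p_τ) g| ≤ tv · osc g` (`abs_sum_sub_mul_le_tv_mul`, FV Lemma 6.34);
* the **sharp tilt bound**: if the conditional weights at `x` in two environments differ by a factor
  `e^{h(s)}` with `|h| ≤ H`, then `tv ≤ (e^H − 1)/(e^H + 1) ≤ H/2` (`tv_le_of_exp_tilt`, `tv_le_half`) —
  the Ising-exact form `tanh K`, via the perfect square `(a−1)(1+(a²−1)x) − (a+1)(a²−1)x(1−x) =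
  (a−1)(1−(a+1)x)²` (`posSum_le_of_ratio`).

References: Friedli–Velenik 2017 §6.5.2, Lemma 6.34; Georgii 2011 Prop. 8.8; Simon 1993 §V.1.
-/

noncomputable section

open Finset Function Real

namespace Summit.Ventures.YMGap.RobustBall.FiniteGibbs

variable {V S : Type*} [DecidableEq V] [Fintype S]

/-! ### Updates -/

omit [Fintype S] in
/-- Configurations agreeing off `x` have the same updates at `x`. [folklore] -/
theorem update_eq_update_of_agree {σ τ : V → S} {x : V} (h : ∀ z, z ≠ x → σ z = τ z) (s : S) :
    update σ x s = update τ x s := by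
  funext z
  by_cases hz : z = x
  · subst hz; simp
  · rw [update_of_ne hz, update_of_ne hz, h z hz]

omit [Fintype S] in
/-- Updates at `x` of configurations agreeing off `y ≠ x` agree off `y`. [folklore] -/
theorem update_agree_of_agree {σ τ : V → S} {x y : V} (h : ∀ z, z ≠ y → σ z = τ z) (s : S) :
    ∀ z, z ≠ y → update σ x s z = update τ x s z := by
  intro z hz
  by_cases hzx : z = x
  · subst hzx; simp
  · rw [update_of_ne hzx, update_of_ne hzx, h z hz]

/-! ### Heat-bath kernels -/

/-- One-site partition function at `x` in the environment `σ`. [folklore] -/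
def siteZ (w : (V → S) → ℝ) (x : V) (σ : V → S) : ℝ := ∑ s, w (update σ x s)

/-- The one-site conditional law (heat-bath probabilities) at `x` given `σ` off `x`. [folklore] -/
def hbProb (w : (V → S) → ℝ) (x : V) (σ : V → S) (s : S) : ℝ := w (update σ x s) / siteZ w x σ

/-- The heat-bath operator: resample the spin at `x` from its conditional law
(Friedli–Velenik 2017, §6.5.2). [cite: FriedliVelenik2017, §6.5.2] -/
def hb (w : (V → S) → ℝ) (x : V) (f : (V → S) → ℝ) (σ : V → S) : ℝ :=
  ∑ s, hbProb w x σ s * f (update σ x s)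

/-- The one-site partition function is positive for a positive weight. [folklore] -/
theorem siteZ_pos [Nonempty S] {w : (V → S) → ℝ} (hw : ∀ σ, 0 < w σ) (x : V) (σ : V → S) :
    0 < siteZ w x σ :=
  Finset.sum_pos (fun _ _ => hw _) Finset.univ_nonempty

/-- Heat-bath probabilities are nonnegative. [folklore] -/
theorem hbProb_nonneg [Nonempty S] {w : (V → S) → ℝ} (hw : ∀ σ, 0 < w σ) (x : V) (σ : V → S) (s : S) :
    0 ≤ hbProb w x σ s :=
  div_nonneg (hw _).le (siteZ_pos hw x σ).le

/-- Heat-bath probabilities sum to one. [folklore] -/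
theorem sum_hbProb [Nonempty S] {w : (V → S) → ℝ} (hw : ∀ σ, 0 < w σ) (x : V) (σ : V → S) :
    ∑ s, hbProb w x σ s = 1 := by
  unfold hbProb
  rw [← Finset.sum_div]
  have hZ : ∑ s, w (update σ x s) = siteZ w x σ := rfl
  rw [hZ]
  exact div_self (siteZ_pos hw x σ).ne'

/-- The heat-bath kernel does not read the spin at `x`. [folklore] -/
theorem hbProb_congr_of_agree {w : (V → S) → ℝ} {x : V} {σ τ : V → S} (h : ∀ z, z ≠ x → σ z = τ z)
    (s : S) : hbProb w x σ s = hbProb w x τ s := by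
  simp only [hbProb, siteZ, update_eq_update_of_agree h]

/-- `hb w x f` does not read the spin at `x`. [folklore] -/
theorem hb_congr_of_agree {w : (V → S) → ℝ} {x : V} (f : (V → S) → ℝ) {σ τ : V → S}
    (h : ∀ z, z ≠ x → σ z = τ z) : hb w x f σ = hb w x f τ := by
  simp only [hb, hbProb_congr_of_agree h, update_eq_update_of_agree h]

/-- `hb` is an average: it is bounded above by any bound of `f`. [folklore] -/
theorem hb_le_of_le [Nonempty S] {w : (V → S) → ℝ} (hw : ∀ σ, 0 < w σ) (x : V) {f : (V → S) → ℝ}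
    {M : ℝ} (hf : ∀ σ, f σ ≤ M) (σ : V → S) : hb w x f σ ≤ M := by
  calc hb w x f σ ≤ ∑ s, hbProb w x σ s * M :=
        Finset.sum_le_sum fun s _ => mul_le_mul_of_nonneg_left (hf _) (hbProb_nonneg hw x σ s)
    _ = M := by rw [← Finset.sum_mul, sum_hbProb hw, one_mul]

/-- `hb` is an average: it is bounded below by any lower bound of `f`. [folklore] -/
theorem le_hb_of_ge [Nonempty S] {w : (V → S) → ℝ} (hw : ∀ σ, 0 < w σ) (x : V) {f : (V → S) → ℝ}
    {m : ℝ} (hf : ∀ σ, m ≤ f σ) (σ : V → S) : m ≤ hb w x f σ := by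
  calc m = ∑ s, hbProb w x σ s * m := by rw [← Finset.sum_mul, sum_hbProb hw, one_mul]
    _ ≤ hb w x f σ := Finset.sum_le_sum fun s _ => mul_le_mul_of_nonneg_left (hf _) (hbProb_nonneg hw x σ s)

/-! ### Total variation of the one-site laws and the transport bound -/

/-- Total-variation distance of the one-site laws at `x` in the environments `σ, τ`:
`∑_s (p_s − q_s)⁺ = ½ ∑_s |p_s − q_s|`. [folklore] -/
def tv (w : (V → S) → ℝ) (x : V) (σ τ : V → S) : ℝ := ∑ s, (hbProb w x σ s - hbProb w x τ s)⁺

omit [DecidableEq V] in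
/-- **Transport bound**: for two probability vectors `p, q` and `g` of oscillation `≤ D`,
`∑ (p − q) g ≤ (∑ (p − q)⁺) · D`. [folklore] -/
theorem sum_sub_mul_le_posSum_mul {p q g : S → ℝ} (hp1 : ∑ s, p s = 1) (hq1 : ∑ s, q s = 1) {D : ℝ}
    (hg : ∀ s s', g s - g s' ≤ D) :
    ∑ s, (p s - q s) * g s ≤ (∑ s, (p s - q s)⁺) * D := by
  have hsum : ∑ s, (p s - q s)⁻ = ∑ s, (p s - q s)⁺ := by
    have h0 : ∑ s, ((p s - q s)⁺ - (p s - q s)⁻) = 0 := by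
      simp only [posPart_sub_negPart, Finset.sum_sub_distrib, hp1, hq1, sub_self]
    rw [Finset.sum_sub_distrib, sub_eq_zero] at h0
    exact h0.symm
  have hsplit : ∑ s, (p s - q s) * g s = ∑ s, (p s - q s)⁺ * g s - ∑ s, (p s - q s)⁻ * g s := by
    rw [← Finset.sum_sub_distrib]
    refine Finset.sum_congr rfl fun s _ => ?_
    rw [← sub_mul, posPart_sub_negPart]
  have hdouble : (∑ s, (p s - q s)⁺) * (∑ s, (p s - q s)⁺ * g s - ∑ s, (p s - q s)⁻ * g s) =
      ∑ s, ∑ s', (p s - q s)⁺ * (p s' - q s')⁻ * (g s - g s') := by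
    rw [mul_sub]
    nth_rewrite 1 [← hsum]
    rw [mul_comm (∑ s, (p s - q s)⁻) _, Finset.sum_mul_sum, Finset.sum_mul_sum,
      ← Finset.sum_sub_distrib]
    refine Finset.sum_congr rfl fun s _ => ?_
    rw [← Finset.sum_sub_distrib]
    exact Finset.sum_congr rfl fun s' _ => by ring
  have hle : ∑ s, ∑ s', (p s - q s)⁺ * (p s' - q s')⁻ * (g s - g s') ≤
      ∑ s, ∑ s', (p s - q s)⁺ * (p s' - q s')⁻ * D :=
    Finset.sum_le_sum fun s _ => Finset.sum_le_sum fun s' _ =>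
      mul_le_mul_of_nonneg_left (hg s s') (mul_nonneg (posPart_nonneg _) (negPart_nonneg _))
  have hprod : ∑ s, ∑ s', (p s - q s)⁺ * (p s' - q s')⁻ * D =
      (∑ s, (p s - q s)⁺) * ((∑ s, (p s - q s)⁺) * D) := by
    nth_rewrite 2 [← hsum]
    rw [← mul_assoc, Finset.sum_mul_sum, Finset.sum_mul]
    refine Finset.sum_congr rfl fun s _ => ?_
    rw [Finset.sum_mul]
  have hA0 : 0 ≤ ∑ s, (p s - q s)⁺ := Finset.sum_nonneg fun s _ => posPart_nonneg _
  rw [hsplit]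
  rcases hA0.eq_or_lt with hA | hA
  · have hz : ∀ s, (p s - q s)⁺ = 0 := fun s =>
      (Finset.sum_eq_zero_iff_of_nonneg fun s _ => posPart_nonneg _).1 hA.symm s (Finset.mem_univ s)
    have hz' : ∀ s, (p s - q s)⁻ = 0 := fun s =>
      (Finset.sum_eq_zero_iff_of_nonneg fun s _ => negPart_nonneg _).1 (hsum.trans hA.symm) s
        (Finset.mem_univ s)
    simp [hz, hz']
  · have key : (∑ s, (p s - q s)⁺) * (∑ s, (p s - q s)⁺ * g s - ∑ s, (p s - q s)⁻ * g s) ≤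
        (∑ s, (p s - q s)⁺) * ((∑ s, (p s - q s)⁺) * D) := by
      rw [hdouble]; exact hle.trans hprod.le
    exact le_of_mul_le_mul_left key hA

/-- `|∑_s (p_σ(s) − p_τ(s)) g s| ≤ tv · D` for the one-site laws and `g` of oscillation `≤ D`
(Friedli–Velenik 2017, proof of Lemma 6.34). [cite: FriedliVelenik2017, Lemma 6.34] -/
theorem abs_sum_sub_mul_le_tv_mul [Nonempty S] {w : (V → S) → ℝ} (hw : ∀ σ, 0 < w σ) (x : V)
    (σ τ : V → S) {g : S → ℝ} {D : ℝ} (hg : ∀ s s', g s - g s' ≤ D) :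
    |∑ s, (hbProb w x σ s - hbProb w x τ s) * g s| ≤ tv w x σ τ * D := by
  have hστ := sum_sub_mul_le_posSum_mul (g := g) (sum_hbProb hw x σ) (sum_hbProb hw x τ) hg
  have hτσ := sum_sub_mul_le_posSum_mul (g := g) (sum_hbProb hw x τ) (sum_hbProb hw x σ) hg
  -- the two positive-part sums coincide (both laws are probability vectors)
  have hsym : ∑ s, (hbProb w x τ s - hbProb w x σ s)⁺ = tv w x σ τ := by
    rw [tv]
    have h0 : ∑ s, ((hbProb w x σ s - hbProb w x τ s)⁺ - (hbProb w x σ s - hbProb w x τ s)⁻) = 0 := by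
      simp only [posPart_sub_negPart, Finset.sum_sub_distrib, sum_hbProb hw, sub_self]
    rw [Finset.sum_sub_distrib, sub_eq_zero] at h0
    rw [h0]
    refine Finset.sum_congr rfl fun s _ => ?_
    rw [negPart_def, neg_sub, posPart_def]
  rw [abs_le]
  refine ⟨?_, hστ⟩
  have : ∑ s, (hbProb w x τ s - hbProb w x σ s) * g s ≤ tv w x σ τ * D := hsym ▸ hτσ
  have hneg : ∑ s, (hbProb w x σ s - hbProb w x τ s) * g s =
      -∑ s, (hbProb w x τ s - hbProb w x σ s) * g s := by
    rw [← Finset.sum_neg_distrib]; exact Finset.sum_congr rfl fun s _ => by ring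
  rw [hneg]; linarith

/-! ### The sharp one-site total-variation bound -/

omit [DecidableEq V] in
/-- **Sharp total-variation bound for a bounded tilt** (the elementary core): `u > 0` a weight on `S`,
`v = u · r` with `0 < r` and `r s ≤ a² r s'` for all `s, s'` (`a ≥ 1`); then the normalised vectors
satisfy `∑ (q − p)⁺ ≤ (a − 1)/(a + 1)`.  Proof: with `A = {p ≤ q}`, `x = p(A)`, `y = q(A)` one has
`y(1−x) ≤ a² x(1−y)`, whence `y − x ≤ (a²−1)x(1−x)/(1+(a²−1)x) ≤ (a−1)/(a+1)` by the perfect square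
`(1 − (a+1)x)² ≥ 0`. [folklore] -/
theorem posSum_le_of_ratio {u r : S → ℝ} (hu : ∀ s, 0 < u s) (hr : ∀ s, 0 < r s) {a : ℝ} (ha : 1 ≤ a)
    (hrr : ∀ s s', r s ≤ a ^ 2 * r s') [Nonempty S] :
    ∑ s, ((u s * r s) / (∑ s', u s' * r s') - u s / ∑ s', u s')⁺ ≤ (a - 1) / (a + 1) := by
  classical
  set Zu := ∑ s', u s' with hZu
  set Zv := ∑ s', u s' * r s' with hZv
  have hZu0 : 0 < Zu := Finset.sum_pos (fun s _ => hu s) Finset.univ_nonempty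
  have hZv0 : 0 < Zv := Finset.sum_pos (fun s _ => mul_pos (hu s) (hr s)) Finset.univ_nonempty
  set p : S → ℝ := fun s => u s / Zu with hp
  set q : S → ℝ := fun s => u s * r s / Zv with hq
  set A := Finset.univ.filter fun s => p s ≤ q s with hAdef
  have hp0 : ∀ s, 0 ≤ p s := fun s => div_nonneg (hu s).le hZu0.le
  have hq0 : ∀ s, 0 ≤ q s := fun s => div_nonneg (mul_pos (hu s) (hr s)).le hZv0.le
  have hp1 : ∑ s, p s = 1 := by simp only [hp]; rw [← Finset.sum_div, ← hZu, div_self hZu0.ne']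
  have hq1 : ∑ s, q s = 1 := by simp only [hq]; rw [← Finset.sum_div, ← hZv, div_self hZv0.ne']
  set x := ∑ s ∈ A, p s with hx
  set y := ∑ s ∈ A, q s with hy
  -- the positive-part sum is `y - x`
  have hpos : ∑ s, (q s - p s)⁺ = y - x := by
    rw [← Finset.sum_filter_add_sum_filter_not Finset.univ (fun s => p s ≤ q s)]
    have h1 : ∑ s ∈ A, (q s - p s)⁺ = y - x := by
      rw [hy, hx, ← Finset.sum_sub_distrib]
      refine Finset.sum_congr rfl fun s hs => ?_
      rw [Finset.mem_filter] at hs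
      exact posPart_eq_self.2 (sub_nonneg.2 hs.2)
    have h2 : ∑ s ∈ Finset.univ.filter (fun s => ¬p s ≤ q s), (q s - p s)⁺ = 0 := by
      refine Finset.sum_eq_zero fun s hs => ?_
      rw [Finset.mem_filter, not_le] at hs
      exact posPart_eq_zero.2 (sub_nonpos.2 hs.2.le)
    rw [← hAdef, h1, h2, add_zero]
  -- bounds `0 ≤ x ≤ 1`, `0 ≤ y ≤ 1`
  have hx0 : 0 ≤ x := Finset.sum_nonneg fun s _ => hp0 s
  have hx1 : x ≤ 1 := hp1 ▸ Finset.sum_le_univ_sum_of_nonneg hp0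
  have hy1 : y ≤ 1 := hq1 ▸ Finset.sum_le_univ_sum_of_nonneg hq0
  have hxc : ∑ s ∈ Aᶜ, p s = 1 - x := by
    rw [← hp1, ← Finset.sum_add_sum_compl A p]; ring
  have hyc : ∑ s ∈ Aᶜ, q s = 1 - y := by
    rw [← hq1, ← Finset.sum_add_sum_compl A q]; ring
  -- the key ratio inequality `y (1 - x) ≤ a² x (1 - y)`
  have key : y * (1 - x) ≤ a ^ 2 * (x * (1 - y)) := by
    rw [← hxc, ← hyc, hy, hx, Finset.sum_mul_sum, Finset.sum_mul_sum, Finset.mul_sum]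
    refine Finset.sum_le_sum fun s _ => ?_
    rw [Finset.mul_sum]
    refine Finset.sum_le_sum fun s' _ => ?_
    simp only [hp, hq]
    rw [div_mul_div_comm, div_mul_div_comm, mul_comm Zu Zv]
    rw [mul_div_assoc', div_le_div_iff_of_pos_right (mul_pos hZv0 hZu0)]
    calc u s * r s * u s' = (u s * u s') * r s := by ring
      _ ≤ (u s * u s') * (a ^ 2 * r s') :=
          mul_le_mul_of_nonneg_left (hrr s s') (mul_pos (hu s) (hu s')).le
      _ = a ^ 2 * (u s * (u s' * r s')) := by ring
  -- conclude with the perfect square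
  rw [hpos]
  have ha1 : 0 < a + 1 := by linarith
  have ha2 : 0 ≤ a ^ 2 - 1 := by nlinarith
  have hden : 0 < 1 + (a ^ 2 - 1) * x := by
    have := mul_nonneg ha2 hx0
    linarith
  rw [le_div_iff₀ ha1]
  have step1 : (y - x) * (1 + (a ^ 2 - 1) * x) ≤ (a ^ 2 - 1) * x * (1 - x) := by nlinarith [key]
  have step2 : (a + 1) * ((a ^ 2 - 1) * x * (1 - x)) ≤ (a - 1) * (1 + (a ^ 2 - 1) * x) := by
    nlinarith [mul_nonneg (sub_nonneg.2 ha) (sq_nonneg (1 - (a + 1) * x))]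
  have h3 : (y - x) * (a + 1) * (1 + (a ^ 2 - 1) * x) ≤ (a - 1) * (1 + (a ^ 2 - 1) * x) := by
    nlinarith [mul_le_mul_of_nonneg_left step1 ha1.le]
  exact le_of_mul_le_mul_right h3 hden

/-- **One-site total variation under a bounded tilt**: if the conditional weights at `x` in the
environments `σ, τ` differ by a factor `e^{h(s)}` with `|h| ≤ H`, then
`tv ≤ (e^H − 1)/(e^H + 1)` (`= tanh(H/2)`; Georgii 2011 Prop. 8.8 in sharp form). [cite: Georgii2011, Prop. 8.8] -/
theorem tv_le_of_exp_tilt [Nonempty S] {w : (V → S) → ℝ} (hw : ∀ σ, 0 < w σ) (x : V) (σ τ : V → S)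
    {h : S → ℝ} {H : ℝ} (hH : ∀ s, |h s| ≤ H)
    (hwh : ∀ s, w (update τ x s) = w (update σ x s) * Real.exp (h s)) :
    tv w x σ τ ≤ (Real.exp H - 1) / (Real.exp H + 1) := by
  have hH0 : 0 ≤ H := (abs_nonneg _).trans (hH (Classical.arbitrary S))
  have ha : 1 ≤ Real.exp H := Real.one_le_exp hH0
  have hrr : ∀ s s', Real.exp (h s) ≤ Real.exp H ^ 2 * Real.exp (h s') := by
    intro s s'
    rw [← Real.exp_nat_mul, ← Real.exp_add, Real.exp_le_exp]
    have h1 := (abs_le.1 (hH s)).2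
    have h2 := (abs_le.1 (hH s')).1
    push_cast; linarith
  have hmain := posSum_le_of_ratio (u := fun s => w (update σ x s)) (r := fun s => Real.exp (h s))
    (fun s => hw _) (fun s => Real.exp_pos _) ha hrr
  -- identify the two normalised vectors with the heat-bath laws
  have hq : ∀ s, w (update σ x s) * Real.exp (h s) / ∑ s', w (update σ x s') * Real.exp (h s') =
      hbProb w x τ s := fun s => by
    simp only [hbProb, siteZ, hwh]
  have hp : ∀ s, w (update σ x s) / ∑ s', w (update σ x s') = hbProb w x σ s := fun s => rfl
  simp only [hq, hp] at hmain
  -- `tv w x σ τ = ∑ (p_τ − p_σ)⁺` by symmetry of the positive-part sums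
  have hsym : tv w x σ τ = ∑ s, (hbProb w x τ s - hbProb w x σ s)⁺ := by
    rw [tv]
    have h0 : ∑ s, ((hbProb w x σ s - hbProb w x τ s)⁺ - (hbProb w x σ s - hbProb w x τ s)⁻) = 0 := by
      simp only [posPart_sub_negPart, Finset.sum_sub_distrib, sum_hbProb hw, sub_self]
    rw [Finset.sum_sub_distrib, sub_eq_zero] at h0
    rw [h0]
    exact Finset.sum_congr rfl fun s _ => by rw [negPart_def, neg_sub, posPart_def]
  rw [hsym]; exact hmain

/-- `(e^H − 1)/(e^H + 1) ≤ H/2` for `H ≥ 0` (`tanh(H/2) ≤ H/2`). [folklore] -/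
theorem exp_sub_one_div_le_half {H : ℝ} (hH : 0 ≤ H) : (Real.exp H - 1) / (Real.exp H + 1) ≤ H / 2 := by
  -- `g(t) = t (e^t + 1) - 2 (e^t - 1)` is nondecreasing on `[0, ∞)` with `g 0 = 0`
  have hk : ∀ t : ℝ, 0 ≤ t → 0 ≤ t * Real.exp t - Real.exp t + 1 := by
    intro t ht
    rcases le_or_gt 1 t with h1 | h1
    · nlinarith [mul_nonneg (Real.exp_pos t).le (sub_nonneg.2 h1)]
    · rcases ht.eq_or_lt with h0 | h0
      · rw [← h0]; simp
      · have hb := Real.exp_bound_div_one_sub_of_interval' h0 h1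
        have h1' : 0 < 1 - t := by linarith
        have : Real.exp t * (1 - t) < 1 := by
          calc Real.exp t * (1 - t) < 1 / (1 - t) * (1 - t) := mul_lt_mul_of_pos_right hb h1'
            _ = 1 := by field_simp
        nlinarith
  have hderiv : ∀ t : ℝ, HasDerivAt (fun t => t * (Real.exp t + 1) - 2 * (Real.exp t - 1))
      (t * Real.exp t - Real.exp t + 1) t := by
    intro t
    have h1 : HasDerivAt (fun t : ℝ => t * (Real.exp t + 1)) (1 * (Real.exp t + 1) + t * Real.exp t) t :=
      (hasDerivAt_id t).mul ((Real.hasDerivAt_exp t).add_const 1)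
    have h2 : HasDerivAt (fun t : ℝ => 2 * (Real.exp t - 1)) (2 * Real.exp t) t :=
      ((Real.hasDerivAt_exp t).sub_const 1).const_mul 2
    exact (h1.sub h2).congr_deriv (by ring)
  have hmono : MonotoneOn (fun t => t * (Real.exp t + 1) - 2 * (Real.exp t - 1)) (Set.Ici 0) := by
    refine monotoneOn_of_deriv_nonneg (convex_Ici 0) ?_ ?_ ?_
    · exact fun t _ => (hderiv t).continuousAt.continuousWithinAt
    · exact fun t _ => (hderiv t).differentiableAt.differentiableWithinAt
    · intro t ht
      rw [interior_Ici] at ht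
      rw [(hderiv t).deriv]
      exact hk t (le_of_lt ht)
  have h := hmono (Set.self_mem_Ici (a := (0 : ℝ))) (Set.mem_Ici.2 hH) hH
  norm_num at h
  rw [div_le_div_iff₀ (by positivity) (by norm_num)]
  nlinarith [h]

/-- **One-site total variation under a bounded tilt, linear form**: `tv ≤ H/2`. [folklore] -/
theorem tv_le_half [Nonempty S] {w : (V → S) → ℝ} (hw : ∀ σ, 0 < w σ) (x : V) (σ τ : V → S)
    {h : S → ℝ} {H : ℝ} (hH : ∀ s, |h s| ≤ H)
    (hwh : ∀ s, w (update τ x s) = w (update σ x s) * Real.exp (h s)) : tv w x σ τ ≤ H / 2 :=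
  (tv_le_of_exp_tilt hw x σ τ hH hwh).trans
    (exp_sub_one_div_le_half ((abs_nonneg _).trans (hH (Classical.arbitrary S))))

/-- `tv` vanishes when the two environments have the same conditional weights at `x`. [folklore] -/
theorem tv_eq_zero_of_eq [Nonempty S] {w : (V → S) → ℝ} (x : V) {σ τ : V → S}
    (h : ∀ s, w (update τ x s) = w (update σ x s)) : tv w x σ τ = 0 := by
  simp only [tv, hbProb, siteZ, h, sub_self, posPart_zero, Finset.sum_const_zero]

/-- `tv ≥ 0`. [folklore] -/
theorem tv_nonneg (w : (V → S) → ℝ) (x : V) (σ τ : V → S) : 0 ≤ tv w x σ τ :=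
  Finset.sum_nonneg fun _ _ => posPart_nonneg _

end Summit.Ventures.YMGap.RobustBall.FiniteGibbs

end
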